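import Summits.BirchSwinnertonDyer.BirchSwinnertonDyer.Theorems.AlignedTransportAtTwoMainConjectureTransportAlignedAtTwoKilfordCopyCrossLevelOldLinesHeckeIdeal
import Summits.BirchSwinnertonDyer.BirchSwinnertonDyer.Theorems.AlignedTransportAtTwoMainConjectureTransportAlignedAtTwoKilfordCopyCrossLevelOldLineForm
import HarnessLib

/-!
# Crux C1 `MainConjectureTransportAlignedAtTwo` (stmt-BirchSwinnertonDyer-22296), line `birth`, residual (R2) `stub_lamLawKilford`, UNEQUAL conductors:
# THE MULTI-PRIME OLD LINE AS A T1⁺ DATUM — `F_Q = Σ_{T⊆Q}(∏T)·ι_{∏T} f` at `L = N·∏Q` has rational coefficients and `c·Λ_L(F_Q) ⊆ Λ_E`, so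
# `ModularParametrizationData.jacobiMapForm D L F_Q` is the old-line parametrisation `J₀(L)(ℂ) → E(ℂ)`; it kills the half-classes `[(t•y)/2]` for
# `t` in the mod-2 eigen-ideal `(2, T_p − a_p (p ∉ Q), U_q − 1 (q ∈ Q))` (width seat att-p3 g18; `--supports 22296`)

THEOREMS ONLY (no `def`, no `sorry`, no named fact). The multi-prime version of `…KilfordCopyCrossLevelOldLineForm` (p694559, one prime), on top of
`…CrossLevelOldLinesHeckeIdeal` (p702281). These are the `θ_F`-side rows ((T1⁺) reading + Hecke half of «`θ` kills `U^⊥`») that a level-`L` kernel-letter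
carrier (analogue of -ty's `F1Sign2.KernelLetterCarrierAtTwo` with `D.jacobiMap` ↦ `D.jacobiMapForm L F_Q`) consumes, for the two old lines of the
semistable shape (`…CrossLevelSemistable`, `…CommonLevelLetter`). BSD is not proved by this; C1 is not closed by this.

* `oldLines_cuspCoeff_rational` — `a_n(F_Q) ∈ ℚ`.
* `oldLines_mul_apply_mem_lattice` — `c·φ(F_Q) ∈ Λ_E` for every cycle `φ` (the hypothesis `hg` of `D.jacobiMapForm L F_Q`).
* **`jacobiMapForm_oldLines_half_smul_eq_zero`** — `D.jacobiMapForm L F_Q _ [(t•y)/2] = O` for `t ∈ Ideal.span{2, T_p − a_p(W) (p ∉ Q), T_q − 1 (q ∈ Q)}`,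
  `y ∈ H₁(X₀(L);ℤ)`, given `a_q(W)` even and `q` odd, `q ∤ N` for `q ∈ Q`.

References: Cremona 1997 §2.4, §2.10 [CremonaAlgorithms1997]; Diamond–Shurman 2005 Prop. 5.6.2 [DiamondShurman2005]; Darmon–Diamond–Taylor 1995 §1.3, §4.1
[DarmonDiamondTaylor1995].
-/

noncomputable section

-- justification: the `Summit.BirchSwinnertonDyer.BirchSwinnertonDyer.…` path repeats a component (route-file convention)
set_option linter.dupNamespace false
set_option autoImplicit false

open scoped MatrixGroups ModularForm Classical

open CongruenceSubgroup Complex WeierstrassCurve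
open Literature.NumberTheory.EllipticCurves Literature.NumberTheory.EllipticCurves.ModularForms
open Summit.BirchSwinnertonDyer.Rank1Residual.F1Sign2
open Summit.BirchSwinnertonDyer.BirchSwinnertonDyer.Theorems.AlignedTransportAtTwoKilfordCopyCrossLevelOldLinesHeckeIdeal
open Summit.BirchSwinnertonDyer.BirchSwinnertonDyer.Theorems.AlignedTransportAtTwoKilfordCopyCrossLevelOldLineForm (jacobiMapForm_oldLine_half_eq_zero_iff)

namespace Summit.BirchSwinnertonDyer.BirchSwinnertonDyer.Theorems.AlignedTransportAtTwoKilfordCopyCrossLevelOldLinesForm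

variable {W : WeierstrassCurve ℚ} {N L : ℕ} [NeZero N] [NeZero L]

omit [NeZero L] in
/-- The multi-prime old line has rational `q`-expansion coefficients (`a_n(f) = a_n(W) ∈ ℤ`). [cite: CremonaAlgorithms1997, §2.10] -/
theorem oldLines_cuspCoeff_rational (D : ModularParametrizationData W N) (Q : Finset ℕ) (F : CuspForm (Gamma0 L) 2)
    (hF : ∀ n : ℕ, cuspCoeff F n = ∑ T ∈ Q.powerset, ((∏ q ∈ T, q : ℕ) : ℂ) * (if (∏ q ∈ T, q) ∣ n then cuspCoeff D.f (n / ∏ q ∈ T, q) else 0)) :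
    ∀ n : ℕ, ∃ r : ℚ, cuspCoeff F n = (r : ℂ) := by
  classical
  intro n
  refine ⟨∑ T ∈ Q.powerset, ((∏ q ∈ T, q : ℕ) : ℚ) * (if (∏ q ∈ T, q) ∣ n then (W.LFunction (n / ∏ q ∈ T, q) : ℚ) else 0), ?_⟩
  rw [hF n, Rat.cast_sum]
  refine Finset.sum_congr rfl fun T _ ↦ ?_
  split_ifs with h
  · rw [D.isNewformOf.2]; push_cast; ring
  · push_cast; ring

/-- **`c·φ(F_Q) ∈ Λ_E` for every cycle `φ ∈ H₁(X₀(L);ℤ)`** (`N·∏Q ∣ L`): the hypothesis `hg` of `ModularParametrizationData.jacobiMapForm D L F_Q`.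
[cite: CremonaAlgorithms1997, §2.4 and §2.10] -/
theorem oldLines_mul_apply_mem_lattice (D : ModularParametrizationData W N) (Q : Finset ℕ) (hQ : ∀ q ∈ Q, q.Prime) (hL : N * ∏ q ∈ Q, q ∣ L)
    (F : CuspForm (Gamma0 L) 2)
    (hF : ∀ n : ℕ, cuspCoeff F n = ∑ T ∈ Q.powerset, ((∏ q ∈ T, q : ℕ) : ℂ) * (if (∏ q ∈ T, q) ∣ n then cuspCoeff D.f (n / ∏ q ∈ T, q) else 0)) :
    ∀ φ ∈ periodHomology L, (D.c : ℂ) * φ F ∈ D.L.lattice :=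
  fun _ hφ ↦ mul_apply_oldLines_mem Q hQ hL D.f F hF D.L.lattice.toAddSubgroup D.c (fun z hz ↦ D.smul_periodLattice_le z hz) hφ

/-- **THE MULTI-PRIME OLD-LINE HECKE ROW in T1⁺ currency.** `L = N·∏Q` (`Q` odd primes not dividing `N`, `a_q(W)` even for `q ∈ Q` — the Kraus–Oesterlé
parities, theorems in the cross-level setting by `…LevelRaisingParity`): for every `t` in the ideal of `𝕋_ℤ(L)` generated by `2`, `T_p − a_p(W)` (`p` prime,
`p ∉ Q`) and `T_q − 1` (`q ∈ Q`), and every cycle `y`, the old-line parametrisation kills the half-class `[(t•y)/2]`.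
[cite: DiamondShurman2005, Prop. 5.6.2] [cite: CremonaAlgorithms1997, §2.10] -/
theorem jacobiMapForm_oldLines_half_smul_eq_zero (D : ModularParametrizationData W N) (Q : Finset ℕ) (hQ : ∀ q ∈ Q, q.Prime)
    (hQN : ∀ q ∈ Q, ¬ q ∣ N) (hQodd : ∀ q ∈ Q, Odd q) (hL : L = N * ∏ q ∈ Q, q) (hAQ : ∀ q ∈ Q, Even (W.LFunction q))
    (F : CuspForm (Gamma0 L) 2)
    (hF : ∀ n : ℕ, cuspCoeff F n = ∑ T ∈ Q.powerset, ((∏ q ∈ T, q : ℕ) : ℂ) * (if (∏ q ∈ T, q) ∣ n then cuspCoeff D.f (n / ∏ q ∈ T, q) else 0))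
    (hg : ∀ φ ∈ periodHomology L, (D.c : ℂ) * φ F ∈ D.L.lattice)
    {t : HeckeRing0 L 2}
    (ht : t ∈ Ideal.span ({t : HeckeRing0 L 2 | t = 2 ∨ (∃ (p : ℕ) (hp : p.Prime), p ∉ Q ∧ t = HeckeRing0.T L 2 p hp - (W.LFunction p : HeckeRing0 L 2)) ∨
      (∃ (q : ℕ) (hq : q ∈ Q), t = HeckeRing0.T L 2 q (hQ q hq) - 1)}))
    (y : periodHomologyHecke L) :
    D.jacobiMapForm L F hg (Submodule.Quotient.mk ((2 : ℂ)⁻¹ • ((t • y : periodHomologyHecke L) : Module.Dual ℂ (CuspForm (Gamma0 L) 2)))) = 0 := by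
  rw [jacobiMapForm_oldLine_half_eq_zero_iff, D.uniformize_eq_zero_iff]
  have hT : ∀ (p : ℕ) (hp : p.Prime), (haveI : NeZero p := ⟨hp.ne_zero⟩; heckeT (Gamma0 N) 2 p D.f) = cuspCoeff D.f p • D.f :=
    fun p hp ↦ by haveI : NeZero p := ⟨hp.ne_zero⟩; exact D.isNewformOf.1.heckeT_eq_coeff_smul hp
  exact oldLines_half_smul_mem_of_mem_span Q hQ hQN hQodd hL D.f (fun n ↦ W.LFunction n) D.isNewformOf.2 hT hAQ F hF
    D.L.lattice.toAddSubgroup D.c (fun z hz ↦ D.smul_periodLattice_le z hz) ht y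

end Summit.BirchSwinnertonDyer.BirchSwinnertonDyer.Theorems.AlignedTransportAtTwoKilfordCopyCrossLevelOldLinesForm

end
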